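import Literature.MathematicalPhysics.QuantumFieldTheory.BalabanRegulatorChart
import Summits.QuantumFields.YangMills.Theorems.ParabolicTrajectoryBalabanStepParabolicStubParabolicBlock
import Summits.QuantumFields.YangMills.Theorems.InfraredLiouvilleRepellerLemmaChartRepeller
import HarnessLib

/-!
# Route `InfraredLiouville`, item `RepellerLemma` — the perfect-action regulator chart repels in the coupling

Support file for item `stmt-QuantumFields-9757` (`RepellerLemma`, card K2 of route `InfraredLiouville` on
`YangMills`; INFORMAL at the time of writing, so nothing here closes it). The item's informal text asks for a chart
with a NON-NEGATIVE marginal coordinate `g : 𝒰 → ℝ≥0`; the tree's posited half-chart structure of that shape is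
`RegulatorChart G r M` (smooth half-chart normal form `SmoothHalfChart` on `g ∈ [0, δ]`, `b = b₀ log M`,
`0 < b₀`, `2 ≤ M`). This file transfers the abstract repeller dynamics of
`InfraredLiouvilleRepellerLemmaChartRepeller` to orbits of the GENUINE half-chart maps `(𝒞.φ, 𝒞.Ψ)` with
non-negative couplings, through the landed Lipschitz bridge `stub_parabolicBlock` (odd/even extension
`(φ', Ψ')` agreeing with `(𝒞.φ, 𝒞.Ψ)` on `g ≥ 0` and carrying `ParabolicBlock` / `BasinBlock`):

* `regulatorChart_freePoint_repels` — there is `δ₁ > 0` such that every orbit of `(𝒞.φ, 𝒞.Ψ)` with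
  non-negative couplings, fibre started in `B̄_{δ₁}` and coupling `g₀ > 0` reaches `g_k > δ₁`;
* `regulatorChart_eventually_coupling_eq_zero` — an orbit of any map whose coupling is renormalised by `𝒞.φ`,
  with non-negative couplings, that converges to the perfect action `(0, 0)` has coupling `0` from some step on.
-/

open Filter Topology
open Literature.MathematicalPhysics.QuantumFieldTheory
open Summit.QuantumFields.YangMills.Theorems.BalabanStepParabolic

namespace Summit.QuantumFields.YangMills.Theorems.RepellerLemma

variable {G : Type} [Group G] [TopologicalSpace G] [IsTopologicalGroup G] [CompactSpace G]
  [MeasurableSpace G] [BorelSpace G] {r : LatticeRep G} {M : ℕ} (𝒞 : RegulatorChart G r M)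

/-- `b = b₀ log M > 0` for a regulator chart (`0 < b₀`, `2 ≤ M`). [folklore] -/
theorem regulatorChart_b_pos : 0 < 𝒞.b₀ * Real.log M := by
  have hM : (1 : ℝ) < M := by exact_mod_cast (lt_of_lt_of_le one_lt_two 𝒞.two_le_M)
  exact mul_pos 𝒞.b₀_pos (Real.log_pos hM)

/-- **The Lipschitz extension of a regulator chart carries the repeller hypotheses**: maps `(φ', Ψ')` agreeing
with `(𝒞.φ, 𝒞.Ψ)` on `g ≥ 0`, a constant `C' > 0`, the parabolic lower/upper bound for `φ'` and the fibre bound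
`‖Ψ' g y‖ ≤ θ' ‖y‖ + C' g²` on the chart ball. [folklore] -/
theorem regulatorChart_extension :
    ∃ (φ' : ℝ → 𝒞.E → ℝ) (Ψ' : ℝ → 𝒞.E → 𝒞.E) (C' : ℝ), 0 < C' ∧
      (∀ g : ℝ, 0 ≤ g → ∀ y : 𝒞.E, φ' g y = 𝒞.φ g y ∧ Ψ' g y = 𝒞.Ψ g y) ∧
      (∀ g : ℝ, ∀ y : 𝒞.E, |g| ≤ 𝒞.δ → ‖y‖ ≤ 𝒞.δ →
        |φ' g y - (g + 𝒞.b₀ * Real.log M * g ^ 3)| ≤ C' * (g ^ 4 + |g| ^ 3 * ‖y‖)) ∧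
      (∀ g : ℝ, ∀ y : 𝒞.E, |g| ≤ 𝒞.δ → ‖y‖ ≤ 𝒞.δ → ‖Ψ' g y‖ ≤ 𝒞.θ' * ‖y‖ + C' * g ^ 2) := by
  have hs := 𝒞.smooth
  obtain ⟨φ', Ψ', C', hC', hagree, hPB, hBB⟩ :=
    stub_parabolicBlock 𝒞.E 𝒞.φ 𝒞.Ψ 𝒞.A 𝒞.φg 𝒞.φy 𝒞.Ψg 𝒞.Ψy (𝒞.b₀ * Real.log M) 𝒞.C 𝒞.δ 𝒞.R 𝒞.θ' hs
  refine ⟨φ', Ψ', C', hC', hagree, fun g y hg hy => (hPB.1 g y hg hy).1, fun g y hg hy => ?_⟩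
  have hδR := hs.δ_le_R
  have hR0 : 0 ≤ 𝒞.R := hs.δ_pos.le.trans hδR
  have h1 := hBB.1 g y 0 hg (hy.trans hδR) (by simpa using hR0)
  have h2 := (hPB.1 g 0 hg (by simpa using hs.δ_pos.le)).2
  simp only [map_zero, sub_zero, norm_zero] at h1 h2
  have h2' : ‖Ψ' g 0‖ ≤ C' * g ^ 2 := by
    simpa [zero_pow two_ne_zero] using h2
  calc ‖Ψ' g y‖ = ‖(Ψ' g y - Ψ' g 0) + Ψ' g 0‖ := by rw [sub_add_cancel]
    _ ≤ ‖Ψ' g y - Ψ' g 0‖ + ‖Ψ' g 0‖ := norm_add_le _ _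
    _ ≤ 𝒞.θ' * ‖y‖ + C' * g ^ 2 := add_le_add h1 h2'

/-- **The perfect action repels in the coupling** (half-chart form of the repeller lemma): there is `δ₁ > 0`
such that every orbit of the genuine chart maps `(𝒞.φ, 𝒞.Ψ)` with non-negative couplings, fibre started in
`B̄_{δ₁}` and coupling `g₀ > 0` reaches a coupling `> δ₁`. [folklore] -/
theorem regulatorChart_freePoint_repels :
    ∃ δ₁ > 0, ∀ p : ℕ → ℝ × 𝒞.E,
      (∀ k, (p (k + 1)).1 = 𝒞.φ (p k).1 (p k).2) → (∀ k, (p (k + 1)).2 = 𝒞.Ψ (p k).1 (p k).2) →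
      (∀ k, 0 ≤ (p k).1) → ‖(p 0).2‖ ≤ δ₁ → 0 < (p 0).1 → ∃ k, δ₁ < (p k).1 := by
  obtain ⟨φ', Ψ', C', hC', hagree, H, HΨ⟩ := regulatorChart_extension 𝒞
  have hs := 𝒞.smooth
  obtain ⟨δ₁, hδ₁, hδ₁δ, h4, hΨ⟩ :=
    exists_repellerRadius_of_consts hs.δ_pos (regulatorChart_b_pos 𝒞) hC'.le 𝒞.θ'_lt_one
  refine ⟨δ₁, hδ₁, fun p hp hp2 hnn hy0 hg0 => ?_⟩
  have hp' : ∀ k, (p (k + 1)).1 = φ' (p k).1 (p k).2 := fun k => by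
    rw [(hagree _ (hnn k) _).1]; exact hp k
  have hp2' : ∀ k, (p (k + 1)).2 = Ψ' (p k).1 (p k).2 := fun k => by
    rw [(hagree _ (hnn k) _).2]; exact hp2 k
  obtain ⟨k, hk⟩ := exists_escape H HΨ (regulatorChart_b_pos 𝒞) hC'.le hs.θ'_nonneg hδ₁δ h4 hΨ p hp'
    hp2' hy0 hg0.ne'
  exact ⟨k, by rwa [abs_of_nonneg (hnn k)] at hk⟩

/-- **No orbit with non-negative couplings reaches the perfect action from `g > 0`**: an orbit of any map
whose coupling coordinate is renormalised by `𝒞.φ` (nothing assumed on the fibre map), with non-negative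
couplings, converging to `(0, 0)` has identically vanishing coupling from some step on. [folklore] -/
theorem regulatorChart_eventually_coupling_eq_zero (p : ℕ → ℝ × 𝒞.E)
    (hp : ∀ k, (p (k + 1)).1 = 𝒞.φ (p k).1 (p k).2) (hnn : ∀ k, 0 ≤ (p k).1)
    (hlim : Tendsto p atTop (𝓝 0)) : ∀ᶠ k in atTop, (p k).1 = 0 := by
  obtain ⟨φ', Ψ', C', hC', hagree, H, -⟩ := regulatorChart_extension 𝒞
  have hs := 𝒞.smooth
  obtain ⟨δ₁, hδ₁, hδ₁δ, h4, -⟩ :=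
    exists_repellerRadius_of_consts hs.δ_pos (regulatorChart_b_pos 𝒞) hC'.le 𝒞.θ'_lt_one
  have hp' : ∀ k, (p (k + 1)).1 = φ' (p k).1 (p k).2 := fun k => by
    rw [(hagree _ (hnn k) _).1]; exact hp k
  exact eventually_fst_eq_zero_of_tendsto H hC'.le hδ₁ hδ₁δ h4 p hp' hlim

end Summit.QuantumFields.YangMills.Theorems.RepellerLemma
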